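import Summits.AtomisticToContinuum.FouriersLaw.Theorems.BondHeatUncertaintyDefs
import Literature.MathematicalPhysics.KineticTheory.LangevinChainTheorem51
import Literature.MathematicalPhysics.KineticTheory.LangevinChainEnergyIdentity
import Literature.Probability.Process.KrylovBogoliubov

/-!
# Finite-bias Clausius (stub `stub_finiteBiasClausius`), helper 4: uniform exponential moments along the orbit of an initial law, polynomial observables, measurability of the raw observable

Helper file for crux `stmt-AtomisticToContinuum-9122` (`BondHeatUncertainty.LinearResponseFTUR`), line
`lebesgue-flip-duality`, stub `stub_finiteBiasClausius`. Dynamics-side inputs of the transient fluctuation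
theorem for the pinned chain (`ω₂, lam, β, γ > 0`, `N ≥ 2`, `T_L, T_R > 0`):

* `clausius_orbit_exp_bound` — the Krylov–Bogoliubov orbit bound from an initial law `ν` with
  `e^{ϑH} ∈ L¹(ν)`, `0 < ϑ < 1/max(T_L,T_R)`: `sup_s ∫ e^{ϑH} d(νP_s) < ∞` (H2 at `t* = 1`,
  `pinnedChain_H2_of_pos`, the local bound (3.4) on `[0, 1)` and the iteration
  `Literature.Probability.Process.MarkovSemigroup.lintegral_kernel_le_of_lyapunov`, integrated against `ν`)
  — registered sub-goal of the stub;
* `clausius_pointwise_bounds` — `p_i²`, `|p_i ∂_{q_i}H|` and `(p_i ∂_{q_i}H)²` are `≤ K e^{ϑH}`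
  (polynomial energy bounds of `LangevinChainSDE.lean`);
* `clausius_measurable_rawObs` — the raw observable `(z, X_t, I_L, I_R, Q^b)` of the forward path is
  jointly measurable in `(z, w)`.

Nothing here closes an item.
-/

noncomputable section

namespace Summit.AtomisticToContinuum.FouriersLaw.Theorems.LinearResponseFTUR

open MeasureTheory ProbabilityTheory Filter Topology Set
open scoped NNReal ENNReal
open Literature.MathematicalPhysics.KineticTheory
open Literature.MathematicalPhysics.KineticTheory.HeatConduction
open Literature.Probability.Process Literature.Probability.Process.MarkovSemigroup
open Summit.AtomisticToContinuum.FouriersLaw.Theorems.BondHeatUncertainty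
open OscillatorChain

/-- **Uniform exponential moments along the orbit of an initial law** (registered sub-goal of
`stub_finiteBiasClausius`). For the pinned chain (`ω₂, lam, β, γ > 0`, `N ≥ 2`, `T_L, T_R > 0`),
`0 < ϑ < 1/max(T_L,T_R)` and a finite initial measure `ν` with `e^{ϑH} ∈ L¹(ν)`:
`sup_{s ≥ 0} ∫ e^{ϑH} d(ν P_s) < ∞`. Proof: H2 at `t* = 1` (`pinnedChain_H2_of_pos`:
`P_1 e^{ϑH} ≤ a e^{ϑH} + c`, `a < 1`) and (3.4) on `[0,1)` (`P_r e^{ϑH} ≤ e^{ϑγ(T_L+T_R)} e^{ϑH}`) give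
`P_s e^{ϑH} ≤ e^{ϑγ(T_L+T_R)} e^{ϑH} + B` for all `s` (`lintegral_kernel_le_of_lyapunov`, CEHR (3.5)–(3.6));
integrate against `ν`. -/
theorem clausius_orbit_exp_bound :
    ∀ (ω₂ lam β γ : ℝ) (hω : 0 < ω₂) (hl : 0 < lam) (hβ : 0 < β) (hγ : 0 < γ) (N : ℕ), 1 < N →
    ∀ (T_L T_R : ℝ), 0 < T_L → 0 < T_R → ∀ ϑ : ℝ, 0 < ϑ → ϑ < 1 / max T_L T_R →
    ∀ (ν : Measure (PhaseSpace N)) [IsFiniteMeasure ν],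
      Integrable (fun x => Real.exp (ϑ * (pinnedChain ω₂ lam β γ).hamiltonian N x)) ν →
    ∃ M : ℝ≥0∞, M ≠ ⊤ ∧ ∀ s : ℝ≥0,
      ∫⁻ y, ENNReal.ofReal (Real.exp (ϑ * (pinnedChain ω₂ lam β γ).hamiltonian N y))
        ∂(ν.bind ((pinnedChain ω₂ lam β γ).transitionKernel N T_L T_R s)) ≤ M := by
  intro ω₂ lam β γ hω hl hβ hγ N hN T_L T_R hTL hTR ϑ hϑ hϑ' ν _ hν
  set P := pinnedChain ω₂ lam β γ with hP
  have hN0 : 0 < N := by omega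
  set S := pinnedChainSemigroup hω hl.le hβ.le hγ.le hN0 hTL.le hTR.le with hS
  set κ := P.transitionKernel N T_L T_R with hκ
  haveI : ∀ t, IsMarkovKernel (κ t) := fun t =>
    pinnedChain_isMarkovKernel_transitionKernel hω hl.le hβ.le hγ.le N T_L T_R t
  set Vf : PhaseSpace N → ℝ≥0∞ := fun y => ENNReal.ofReal (Real.exp (ϑ * P.hamiltonian N y)) with hVf
  have hVm : Measurable Vf := ENNReal.measurable_ofReal.comp (Real.measurable_exp.comp
    ((pinnedChain_continuous_hamiltonian ω₂ lam β γ N).measurable.const_mul _))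
  -- H2 at `t* = 1`
  obtain ⟨a, c, K, ha0, ha1, hc, -, hbound⟩ :=
    pinnedChain_H2_of_pos hω hl hβ hγ hN hTL hTR hϑ hϑ' 1 one_pos
  have hlyap : ∀ x, ∫⁻ y, Vf y ∂(κ 1 x) ≤ ENNReal.ofReal a * Vf x + ENNReal.ofReal c := by
    intro x
    refine (hbound x).trans ?_
    rw [hVf, ← ENNReal.ofReal_mul ha0.le, ← ENNReal.ofReal_add (by positivity) hc.le]
    refine ENNReal.ofReal_le_ofReal (add_le_add le_rfl ?_)
    calc c * K.indicator 1 x ≤ c * 1 := by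
          refine mul_le_mul_of_nonneg_left ?_ hc.le
          exact Set.indicator_le_self' (fun _ _ => zero_le_one) x
      _ = c := mul_one c
  -- (3.4) on `[0, 1)`
  have hloc : ∀ r : ℝ≥0, r < 1 → ∀ x, ∫⁻ y, Vf y ∂(κ r x) ≤
      ENNReal.ofReal (Real.exp (ϑ * γ * (T_L + T_R))) * Vf x := by
    intro r hr x
    refine (lintegral_exp_mul_hamiltonian_pinnedChainSemigroup_le hω hl.le hβ.le hγ.le hN0 hTL.le
      hTR.le hTL hTR hϑ hϑ' r x).trans ?_
    rw [hVf, ← ENNReal.ofReal_mul (by positivity)]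
    refine ENNReal.ofReal_le_ofReal (mul_le_mul_of_nonneg_right ?_ (by positivity))
    refine Real.exp_le_exp.2 ?_
    have hr' : ((r : ℝ≥0) : ℝ) ≤ 1 := by exact_mod_cast hr.le
    have h0 : 0 ≤ ϑ * γ * (T_L + T_R) := by positivity
    nlinarith
  obtain ⟨B, hBtop, hB⟩ := exists_fixedBound (ENNReal.ofReal_lt_one.2 ha1) ENNReal.ofReal_ne_top
  have key : ∀ (s : ℝ≥0) (x : PhaseSpace N), ∫⁻ y, Vf y ∂(κ s x) ≤
      ENNReal.ofReal (Real.exp (ϑ * γ * (T_L + T_R))) * Vf x + B :=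
    lintegral_kernel_le_of_lyapunov κ S.kernel_zero S.kernel_add hVm one_pos
      (ENNReal.ofReal_lt_one.2 ha1).le hB hlyap hloc
  -- integrate against `ν`
  have hνV : ∫⁻ x, Vf x ∂ν ≠ ⊤ := by
    have h := hν.hasFiniteIntegral
    rw [hasFiniteIntegral_iff_ofReal (Eventually.of_forall fun x => (Real.exp_pos _).le)] at h
    exact h.ne
  refine ⟨ENNReal.ofReal (Real.exp (ϑ * γ * (T_L + T_R))) * ∫⁻ x, Vf x ∂ν + B * ν univ,
    ENNReal.add_ne_top.2 ⟨ENNReal.mul_ne_top ENNReal.ofReal_ne_top hνV,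
      ENNReal.mul_ne_top hBtop (measure_ne_top ν _)⟩, fun s => ?_⟩
  rw [Measure.lintegral_bind (Kernel.aemeasurable (κ s)) hVm.aemeasurable]
  calc ∫⁻ x, ∫⁻ y, Vf y ∂(κ s x) ∂ν
      ≤ ∫⁻ x, (ENNReal.ofReal (Real.exp (ϑ * γ * (T_L + T_R))) * Vf x + B) ∂ν :=
        lintegral_mono fun x => key s x
    _ = ENNReal.ofReal (Real.exp (ϑ * γ * (T_L + T_R))) * ∫⁻ x, Vf x ∂ν + B * ν univ := by
        rw [lintegral_add_right _ measurable_const, lintegral_const_mul _ hVm, lintegral_const]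

/-- **Polynomial observables are dominated by `e^{ϑH}`.** For the pinned chain (`ω₂ > 0`,
`lam, β ≥ 0`) and `ϑ > 0` there is `K` with `p_i² ≤ K e^{ϑH}`, `|p_i ∂_{q_i}H| ≤ K e^{ϑH}` and
`(p_i ∂_{q_i}H)² ≤ K e^{ϑH}` everywhere (`|p_i| ≤ N/2 + H`, `∑|∂_qH| ≤ C(1+H)`,
`(1+H)⁴ ≤ 4! e^{ϑ}/ϑ⁴ · e^{ϑH}`). -/
theorem clausius_pointwise_bounds {ω₂ lam β : ℝ} (hω : 0 < ω₂) (hl : 0 ≤ lam) (hβ : 0 ≤ β)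
    (γ : ℝ) (N : ℕ) {ϑ : ℝ} (hϑ : 0 < ϑ) (i : Fin N) :
    ∃ K : ℝ≥0, ∀ x : PhaseSpace N,
      x.2 i ^ 2 ≤ K * Real.exp (ϑ * (pinnedChain ω₂ lam β γ).hamiltonian N x) ∧
      |x.2 i * partialQ i ((pinnedChain ω₂ lam β γ).hamiltonian N) x| ≤
        K * Real.exp (ϑ * (pinnedChain ω₂ lam β γ).hamiltonian N x) ∧
      (x.2 i * partialQ i ((pinnedChain ω₂ lam β γ).hamiltonian N) x) ^ 2 ≤
        K * Real.exp (ϑ * (pinnedChain ω₂ lam β γ).hamiltonian N x) := by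
  -- the constants: `∑|∂_qH| ≤ C₁(1+H)`, `|p ∂_qH| ≤ D(1+H)²`, `(1+H)⁴ ≤ c₄ e^{ϑH}`
  obtain ⟨C₁, hC₁, hC₁0⟩ : ∃ C₁ : ℝ, C₁ = N * (ω₂ / 2 + 3 + lam / ω₂ + N ^ 2 * (3 + β)) ∧ 0 ≤ C₁ := by
    have : 0 ≤ lam / ω₂ := div_nonneg hl hω.le
    exact ⟨_, rfl, by positivity⟩
  obtain ⟨D, hD, hD0⟩ : ∃ D : ℝ, D = (N / 2 + 1) * C₁ ∧ 0 ≤ D := ⟨_, rfl, by positivity⟩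
  obtain ⟨c₄, hc₄, hc₄0⟩ : ∃ c₄ : ℝ, c₄ = 24 * Real.exp ϑ / ϑ ^ 4 ∧ 0 ≤ c₄ :=
    ⟨_, rfl, by positivity⟩
  have hKnn : 0 ≤ (2 + D + D ^ 2) * c₄ := by positivity
  refine ⟨((2 + D + D ^ 2) * c₄).toNNReal, fun x => ?_⟩
  rw [Real.coe_toNNReal _ hKnn]
  obtain ⟨H, hH, hH0⟩ : ∃ H : ℝ, H = (pinnedChain ω₂ lam β γ).hamiltonian N x ∧ 0 ≤ H :=
    ⟨_, rfl, pinnedChain_hamiltonian_nonneg hω.le hl hβ γ N x⟩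
  rw [← hH]
  obtain ⟨u, hu, hu1⟩ : ∃ u : ℝ, u = 1 + H ∧ 1 ≤ u := ⟨_, rfl, by linarith⟩
  have hu0 : 0 ≤ u := by linarith
  -- `u⁴ ≤ c₄ e^{ϑH}`
  have hu4 : u ^ 4 ≤ c₄ * Real.exp (ϑ * H) := by
    have h := Real.pow_div_factorial_le_exp (x := ϑ * u) (by positivity) 4
    have h24 : ((Nat.factorial 4 : ℕ) : ℝ) = 24 := by norm_num [Nat.factorial]
    rw [h24, div_le_iff₀ (by norm_num : (0:ℝ) < 24), mul_pow] at h
    have hexp : Real.exp (ϑ * u) = Real.exp ϑ * Real.exp (ϑ * H) := by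
      rw [← Real.exp_add]; congr 1; rw [hu]; ring
    rw [hexp] at h
    have hϑ4 : 0 < ϑ ^ 4 := by positivity
    rw [hc₄, div_mul_eq_mul_div, le_div_iff₀ hϑ4]
    nlinarith
  have hu2 : u ^ 2 ≤ u ^ 4 := by
    have h1 : 1 ≤ u ^ 2 := one_le_pow₀ hu1
    nlinarith
  have hu14 : u ≤ u ^ 4 := by
    have h1 : 1 ≤ u ^ 3 := one_le_pow₀ hu1
    nlinarith
  -- momentum and force bounds
  have hp2 : x.2 i ^ 2 ≤ 2 * H := by
    have h := pinnedChain_harmonic_le_hamiltonian (ω₂ := ω₂) hl hβ γ N x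
    have h1 : x.2 i ^ 2 / 2 ≤ ∑ j, x.2 j ^ 2 / 2 :=
      Finset.single_le_sum (f := fun j => x.2 j ^ 2 / 2) (fun j _ => by positivity)
        (Finset.mem_univ i)
    have h2 : 0 ≤ ∑ j, ω₂ * x.1 j ^ 2 / 2 := Finset.sum_nonneg fun j _ => by positivity
    rw [← hH] at h
    linarith
  have hp : |x.2 i| ≤ (N / 2 + 1) * u := by
    have h := pinnedChain_sum_abs_momentum_le hω.le hl hβ γ N x
    have h1 : |x.2 i| ≤ ∑ j, |x.2 j| :=
      Finset.single_le_sum (f := fun j => |x.2 j|) (fun j _ => abs_nonneg _) (Finset.mem_univ i)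
    rw [← hH] at h
    have hN0 : (0 : ℝ) ≤ N := Nat.cast_nonneg N
    nlinarith
  have hF : |partialQ i ((pinnedChain ω₂ lam β γ).hamiltonian N) x| ≤ C₁ * u := by
    have h := pinnedChain_sum_abs_partialQ_le hω hl hβ γ N x
    have h1 : |partialQ i ((pinnedChain ω₂ lam β γ).hamiltonian N) x| ≤
        ∑ j, |partialQ j ((pinnedChain ω₂ lam β γ).hamiltonian N) x| :=
      Finset.single_le_sum (f := fun j => |partialQ j ((pinnedChain ω₂ lam β γ).hamiltonian N) x|)
        (fun j _ => abs_nonneg _) (Finset.mem_univ i)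
    rw [← hH, ← hC₁, ← hu] at h
    exact h1.trans h
  have hψ : |x.2 i * partialQ i ((pinnedChain ω₂ lam β γ).hamiltonian N) x| ≤ D * u ^ 2 := by
    rw [abs_mul, hD]
    calc |x.2 i| * |partialQ i ((pinnedChain ω₂ lam β γ).hamiltonian N) x|
        ≤ ((N / 2 + 1) * u) * (C₁ * u) := mul_le_mul hp hF (abs_nonneg _) (by positivity)
      _ = (N / 2 + 1) * C₁ * u ^ 2 := by ring
  have hE : 0 ≤ Real.exp (ϑ * H) := (Real.exp_pos _).le
  have hcE : u ^ 4 ≤ c₄ * Real.exp (ϑ * H) := hu4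
  generalize x.2 i * partialQ i ((pinnedChain ω₂ lam β γ).hamiltonian N) x = v at hψ ⊢
  generalize x.2 i = q at hp2 ⊢
  clear hF hp
  have hce : 0 ≤ c₄ * Real.exp (ϑ * H) := mul_nonneg hc₄0 hE
  have hcoef1 : (2 : ℝ) ≤ 2 + D + D ^ 2 := by nlinarith
  have hcoef2 : D ≤ 2 + D + D ^ 2 := by nlinarith
  have hcoef3 : D ^ 2 ≤ 2 + D + D ^ 2 := by nlinarith
  refine ⟨?_, ?_, ?_⟩
  · calc q ^ 2 ≤ 2 * u ^ 4 := by nlinarith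
      _ ≤ 2 * (c₄ * Real.exp (ϑ * H)) := by linarith
      _ ≤ (2 + D + D ^ 2) * (c₄ * Real.exp (ϑ * H)) := mul_le_mul_of_nonneg_right hcoef1 hce
      _ = (2 + D + D ^ 2) * c₄ * Real.exp (ϑ * H) := by ring
  · calc |v| ≤ D * u ^ 4 := hψ.trans (mul_le_mul_of_nonneg_left hu2 hD0)
      _ ≤ D * (c₄ * Real.exp (ϑ * H)) := mul_le_mul_of_nonneg_left hcE hD0
      _ ≤ (2 + D + D ^ 2) * (c₄ * Real.exp (ϑ * H)) := mul_le_mul_of_nonneg_right hcoef2 hce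
      _ = (2 + D + D ^ 2) * c₄ * Real.exp (ϑ * H) := by ring
  · have h1 : v ^ 2 ≤ (D * u ^ 2) ^ 2 := by
      rw [← sq_abs]
      exact pow_le_pow_left₀ (abs_nonneg _) hψ 2
    calc v ^ 2 ≤ (D * u ^ 2) ^ 2 := h1
      _ = D ^ 2 * u ^ 4 := by ring
      _ ≤ D ^ 2 * (c₄ * Real.exp (ϑ * H)) := mul_le_mul_of_nonneg_left hcE (sq_nonneg D)
      _ ≤ (2 + D + D ^ 2) * (c₄ * Real.exp (ϑ * H)) := mul_le_mul_of_nonneg_right hcoef3 hce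
      _ = (2 + D + D ^ 2) * c₄ * Real.exp (ϑ * H) := by ring

/-- **The raw observable of the forward path is jointly measurable in the start and the noise**
(pinned chain, `ω₂ > 0`, `lam, β, γ ≥ 0`): the endpoint is the measurable solution map, the two work
integrals and the bond heat are parametrised interval integrals of integrands continuous in time and
measurable in `(z, w)`. -/
theorem clausius_measurable_rawObs {ω₂ lam β γ : ℝ} (hω : 0 < ω₂) (hl : 0 ≤ lam) (hβ : 0 ≤ β)
    (hγ : 0 ≤ γ) (N : ℕ) (T_L T_R : ℝ) (i0 iN ib : Fin N) (t : ℝ) :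
    Measurable fun zw : PhaseSpace N × WienerPair =>
      rawObs (pinnedChain ω₂ lam β γ) N i0 iN ib t zw.1
        (fwdPath (pinnedChain ω₂ lam β γ) N T_L T_R zw.1 zw.2) := by
  set P := pinnedChain ω₂ lam β γ with hP
  have hX : ∀ s : ℝ, Measurable fun zw : PhaseSpace N × WienerPair =>
      fwdPath P N T_L T_R zw.1 zw.2 s :=
    fun s => pinnedChain_measurable_solMap_pairPath hω hl hβ hγ N T_L T_R s
  have hXc : ∀ zw : PhaseSpace N × WienerPair, Continuous (fwdPath P N T_L T_R zw.1 zw.2) :=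
    fun zw => pinnedChain_continuous_solMap hω hl hβ hγ N T_L T_R zw.1 (pairPath zw.2)
  have hHs : ContDiff ℝ 1 (P.hamiltonian N) := pinnedChain_contDiff_hamiltonian ω₂ lam β γ N
  have hQc : ∀ i, Continuous (partialQ i (P.hamiltonian N)) := fun i =>
    P.continuous_partialQ_hamiltonian hHs i
  have hW : ∀ i : Fin N, Measurable fun zw : PhaseSpace N × WienerPair =>
      workIntegral P N i t (fwdPath P N T_L T_R zw.1 zw.2) := by
    intro i
    unfold workIntegral
    refine measurable_intervalIntegral_of_continuous_of_measurable (fun zw => ?_) (fun s => ?_) t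
    · exact ((continuous_apply i).comp (continuous_snd.comp (hXc zw))).mul ((hQc i).comp (hXc zw))
    · exact ((measurable_pi_apply i).comp (measurable_snd.comp (hX s))).mul
        ((hQc i).measurable.comp (hX s))
  have hB : Measurable fun zw : PhaseSpace N × WienerPair =>
      bondHeat P N ib t (fwdPath P N T_L T_R zw.1 zw.2) := by
    unfold bondHeat
    refine measurable_intervalIntegral_of_continuous_of_measurable (fun zw => ?_) (fun s => ?_) t
    · exact (pinnedChain_continuous_bondCurrent ω₂ lam β γ N ib).comp (hXc zw)
    · exact (pinnedChain_continuous_bondCurrent ω₂ lam β γ N ib).measurable.comp (hX s)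
  unfold rawObs
  exact measurable_fst.prodMk ((hX t).prodMk ((hW i0).prodMk ((hW iN).prodMk hB)))

end Summit.AtomisticToContinuum.FouriersLaw.Theorems.LinearResponseFTUR

end
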